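import Summits.ResolutionOfSingularities.ResolutionOfSingularities.Theorems.PurelyInseparableDim4TschirnhausCanonicalFrame
import Summits.ResolutionOfSingularities.ResolutionOfSingularities.Theorems.PurelyInseparableDim4TschirnhausIsolation
import HarnessLib
import HarnessLib.Audit.Tags

/-!
# Purely inseparable four-folds — THE ENTRY FRAME OF A POWER-CONE STATE IN THE T-SECTOR, every prime, every shade: ONE Tschirnhaus change
# straightens the cone to `c·x_f^d`, kills the `x_f^{d−1}`-jet to any order, and KEEPS order, boundary, isolation and the polar-kernel rank
# (cell `res-dim4-pi`, K2(p) lane, B-LF (iii-b) K24a-PRIME-σ, ENTRY layer; seat res-dim4-p-1 g6)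

[OURS · counted 0 · cell `res-dim4-pi` · K2(p) lane (holder res-dim4-p-12 g5 rulings g5-18: «ENTRY (σ-edition of β1 + entry-at-a-hit) = p-1 lineage»).
The frame EXISTENCE is my lineage's `FrameChange.exists_canonical_frame_state` (p692665, already (p, d)-generic); this file adds what the β-layer
(res-dim4-p-7 g6 `…TwoSlotLegalitySigma` p719195) and the assembly δ read on the FRAMED state: the boundary monomial survives, the order is kept,
isolation is kept, and the RANK of the polar kernel is kept although the straightening has a LINEAR part (the kernel itself is transported, not
fixed).  Seat res-dim4-p-1 g6.]  Nothing here proves any TAIL(p, d, 3), K2(p), `NoIsolatedTrap p p` or resolution of singularities in dimension ≥ 4 /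
characteristic `p` — NOT proved; a coordinate-change bookkeeping statement about OUR frame.  AI kernel work, weaker than expert review.

* §1 `two_le_ordZero_sub_linear` — the canonical change `φ` minus its linear part `ψ = −Σ_{i≠f} (ℓ_i/ℓ_f)·x_i` has order `≥ 2`;
  `finrank_resVertex_tschState_any` — hence `finrank Vtx` is kept by `tsch f φ` (linear transport `finrank_resVertex_tschState_linear` ∘ pure-jet
  invariance `finrank_resVertex_tschState`, glued by `tsch_comp_tsch`).
* §2 **`twoSlot_entry_frame_sigma`** — at a state with `x^r ∣ F`, `r f = 0`, `ord₀ F = o`, `o − |r| = d ≥ 1`, `(d : K) ≠ 0`, power cone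
  `resForm = C a₀ · (Σ ℓ_i x_i)^d` with `ℓ f ≠ 0` (the T-sector: `f` carries the form), and any jet order `N`: a change `φ` (`φ(0) = 0`, `x_f ∉ φ`) with,
  for the framed polynomial `F̃ := tsch f φ F` and residual `G̃ := tsch f φ (F/x^r)`: `F̃ = x^r · G̃`, `homogeneousComponent d G̃ = C(a₀ ℓ_f^d)·x_f^d`
  (STRAIGHT: `coeff (d·f) G̃ = a₀ ℓ_f^d ≠ 0` and every other degree-`d` coefficient vanishes), NO `x_f^{d−1}`-monomial of degree `≤ N + d − 1`,
  `ord₀ F̃ = ord₀ F`, `IsIsolated q F̃ ↔ IsIsolated q F`, `finrank Vtx(F̃, r) = finrank Vtx(F, r)`.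
Consumers: p-7 g6's `twoSlot_legal_readings_of_corner_sigma` binders `ha`/`hstraight`/`htsch` (N ≥ 2), typ-1 g5's transport glue, the holder's δ.
[cite: CossartJannsenSaito2020, Thm. 3.14, Lemma 11.5] [cite: Hauser2010, §§F–G] [cite: CossartPiltant2008, (16)]
bears_on: LADDER-RESOLUTION:D157-DOOR2 (res-dim4-pi · K2(p) B-LF (iii-b) · K24a-PRIME-σ ENTRY frame).  Supports stmt-ResolutionOfSingularities-16155 (helper).
-/

set_option linter.dupNamespace false -- mandated namespace of this single-conjunct summit

noncomputable section

namespace Summit.ResolutionOfSingularities.ResolutionOfSingularities.Theorems.PIDim4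

namespace FrameChange

open MvPolynomial Finset
open Literature.AlgebraicGeometry.Resolution
open Literature.AlgebraicGeometry.Resolution.CentreBlowup
open Literature.AlgebraicGeometry.Resolution.Hauser2010

variable {K : Type} [Field K] {f : Fin 4}

/-! ## §1 The canonical change minus its linear part has order `≥ 2`; the kernel rank is kept -/

/-- If `φ(0) = 0`, `x_f ∉ φ` and the degree-one coefficients of `φ` are those of the linear form `ψ = Σ c_i x_i` (`c f = 0`), then `φ − ψ` has
order `≥ 2` and does not involve `x_f`. [folklore] -/
theorem two_le_ordZero_sub_linear {φ : MvPolynomial (Fin 4) K} (h0 : constantCoeff φ = 0) (hφ : f ∉ φ.vars) {c : Fin 4 → K}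
    (hc : c f = 0) (hlin : ∀ i, i ≠ f → coeff (Finsupp.single i 1) φ = c i) :
    (2 : ℕ∞) ≤ ordZero (φ - ∑ i, C (c i) * X i) ∧ f ∉ (φ - ∑ i, C (c i) * X i).vars := by
  classical
  have hψ : f ∉ (∑ i, C (c i) * X i : MvPolynomial (Fin 4) K).vars := not_mem_vars_linear hc
  have hvars : f ∉ (φ - ∑ i, C (c i) * X i).vars := fun h =>
    (Finset.mem_union.mp ((MvPolynomial.vars_sub_subset (p := φ) (q := ∑ i, C (c i) * X i)) h)).elim hφ hψ
  refine ⟨two_le_ordZero_of_forall_coeff (f := f) ?_ ?_, hvars⟩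
  · intro a ha
    refine ⟨?_, ?_⟩
    · by_contra haf
      exact hvars ((MvPolynomial.mem_vars_iff_mem_support f).mpr ⟨a, ha, Finsupp.mem_support_iff.mpr haf⟩)
    · by_contra hdeg
      have ha0 : a = 0 := by
        have : a.degree = 0 := by omega
        exact (Finsupp.degree_eq_zero_iff a).mp this
      rw [ha0, MvPolynomial.mem_support_iff] at ha
      apply ha
      rw [coeff_sub, ← constantCoeff_eq, h0,
        constantCoeff_eq_zero_of_isHomogeneous_one (isHomogeneous_linear c), sub_zero]
  · intro m hmf hm1
    obtain ⟨i, hi⟩ : ∃ i, m = Finsupp.single i 1 := by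
      rw [Finsupp.degree_eq_sum] at hm1
      obtain ⟨i, -, hmi⟩ : ∃ i ∈ Finset.univ, m i ≠ 0 := by
        by_contra h
        push Not at h
        have : ∑ x, m x = 0 := Finset.sum_eq_zero h
        omega
      refine ⟨i, ?_⟩
      ext k
      by_cases hk : k = i
      · rw [hk, Finsupp.single_eq_same]
        have hle : m i ≤ 1 := by
          have := Finset.single_le_sum (fun x _ => Nat.zero_le (m x)) (Finset.mem_univ i)
          omega
        omega
      · rw [Finsupp.single_eq_of_ne hk]
        have hsum : m i + m k ≤ ∑ x, m x :=
          Finset.add_le_sum (fun x _ => Nat.zero_le (m x)) (Finset.mem_univ i) (Finset.mem_univ k) (Ne.symm hk)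
        omega
    have hif : i ≠ f := by
      rintro rfl
      rw [hi, Finsupp.single_eq_same] at hmf
      exact one_ne_zero hmf
    rw [hi, coeff_sub, hlin i hif, ResCone.coeff_single_linearForm, sub_self]

/-- **THE POLAR-KERNEL RANK IS KEPT by the canonical change** (linear straightening + Tschirnhaus jet): with `φ`, `c` as in
`two_le_ordZero_sub_linear` and `x^r ∣ F`, `r f = 0`. [OURS] [cite: CossartJannsenSaito2020, Thm. 3.14] -/
theorem finrank_resVertex_tschState_any {φ : MvPolynomial (Fin 4) K} (h0 : constantCoeff φ = 0) (hφ : f ∉ φ.vars) {c : Fin 4 → K}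
    (hc : c f = 0) (hlin : ∀ i, i ≠ f → coeff (Finsupp.single i 1) φ = c i) {s : State K} (hr0 : s.r f = 0)
    (hr : ∀ d ∈ s.F.support, s.r ≤ d) :
    Module.finrank K (ResCone.resVertex (⟨tsch f φ s.F, s.r, s.exc⟩ : State K)) = Module.finrank K (ResCone.resVertex s) := by
  obtain ⟨h2, hvars⟩ := two_le_ordZero_sub_linear h0 hφ hc hlin
  have hψ : f ∉ (∑ i, C (c i) * X i : MvPolynomial (Fin 4) K).vars := not_mem_vars_linear hc
  have hcomp : tsch f φ s.F = tsch f (φ - ∑ i, C (c i) * X i) (tsch f (∑ i, C (c i) * X i) s.F) := by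
    rw [← AlgHom.comp_apply, tsch_comp_tsch _ hψ, add_sub_cancel]
  rw [hcomp]
  rw [finrank_resVertex_tschState hvars h2 (⟨tsch f (∑ i, C (c i) * X i) s.F, s.r, s.exc⟩ : State K)]
  exact finrank_resVertex_tschState_linear hc hr0 hr

/-! ## §2 The entry frame -/

/-- **THE ENTRY FRAME OF A T-SECTOR POWER-CONE STATE** (statement in the module docstring). [OURS]
[cite: CossartJannsenSaito2020, Thm. 3.14, Lemma 11.5] [cite: Hauser2010, §§F–G] [cite: CossartPiltant2008, (16)] -/
theorem twoSlot_entry_frame_sigma (q : ℕ) {s : State K} {o d : ℕ} (hd : 1 ≤ d) (hdK : (d : K) ≠ 0)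
    (ho : ordZero s.F = o) (hr : ∀ e ∈ s.F.support, s.r ≤ e) (hod : o - s.r.degree = d) (hrf : s.r f = 0)
    {a₀ : K} {ℓ : Fin 4 → K} (ha₀ : a₀ ≠ 0) (hℓf : ℓ f ≠ 0)
    (hform : ResCone.resForm s = C a₀ * (∑ i, C (ℓ i) * X i) ^ d) (N : ℕ) :
    ∃ φ : MvPolynomial (Fin 4) K, constantCoeff φ = 0 ∧ f ∉ φ.vars ∧
      tsch f φ s.F = monomial s.r 1 * tsch f φ (s.F.divMonomial s.r) ∧
      homogeneousComponent d (tsch f φ (s.F.divMonomial s.r)) = C (a₀ * ℓ f ^ d) * X f ^ d ∧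
      coeff (Finsupp.single f d) (tsch f φ (s.F.divMonomial s.r)) = a₀ * ℓ f ^ d ∧ a₀ * ℓ f ^ d ≠ 0 ∧
      (∀ m : Fin 4 →₀ ℕ, m.degree = d → m ≠ Finsupp.single f d → coeff m (tsch f φ (s.F.divMonomial s.r)) = 0) ∧
      (∀ n : Fin 4 →₀ ℕ, n f = d - 1 → n.degree ≤ N + (d - 1) → coeff n (tsch f φ (s.F.divMonomial s.r)) = 0) ∧
      ordZero (tsch f φ s.F) = ordZero s.F ∧ (IsIsolated q (tsch f φ s.F) ↔ IsIsolated q s.F) ∧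
      Module.finrank K (ResCone.resVertex (⟨tsch f φ s.F, s.r, s.exc⟩ : State K)) =
        Module.finrank K (ResCone.resVertex s) := by
  classical
  obtain ⟨φ, h0, hφ, hlin, hhom, hjet⟩ := exists_canonical_frame_state f hd hdK ho hr hod ha₀ hℓf hform N
  have hc : (fun i => if i = f then (0 : K) else -(ℓ i / ℓ f)) f = 0 := by simp
  have hlin' : ∀ i, i ≠ f → coeff (Finsupp.single i 1) φ = (fun i => if i = f then (0 : K) else -(ℓ i / ℓ f)) i :=
    fun i hi => by rw [hlin i hi, straighten_coeff_of_ne ℓ hi]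
  have hne : a₀ * ℓ f ^ d ≠ 0 := mul_ne_zero ha₀ (pow_ne_zero _ hℓf)
  have hcoeff : ∀ m : Fin 4 →₀ ℕ, m.degree = d →
      coeff m (tsch f φ (s.F.divMonomial s.r)) = coeff m (C (a₀ * ℓ f ^ d) * X f ^ d) := fun m hm => by
    rw [← hhom, coeff_homogeneousComponent, if_pos hm]
  refine ⟨φ, h0, hφ, ?_, hhom, ?_, hne, ?_, hjet, ordZero_tsch hφ h0 s.F, isIsolated_tsch_iff q hφ h0 s.F,
    finrank_resVertex_tschState_any h0 hφ hc hlin' hrf hr⟩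
  · conv_lhs => rw [eq_monomial_mul_divMonomial hr]
    exact tsch_monomial_mul φ hrf _
  · rw [hcoeff _ (by rw [Finsupp.degree_single]), coeff_C_mul, coeff_X_pow, if_pos rfl, mul_one]
  · intro m hm hmf
    rw [hcoeff m hm, coeff_C_mul, coeff_X_pow, if_neg (fun h => hmf h.symm), mul_zero]

end FrameChange

end Summit.ResolutionOfSingularities.ResolutionOfSingularities.Theorems.PIDim4

end
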